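import Summits.CriticalPhenomena.PercolationContinuityZ3.Theses.PercNearOneGluing
import Literature.Probability.Percolation.PercolationEvents
import HarnessLib.Audit

/-! TTRL-lite variant V2510 of stmt-CriticalPhenomena-4574 -/

namespace Summit.CriticalPhenomena.PercolationContinuityZ3.Theorems

open MeasureTheory Set Literature.Probability.LatticeModels Literature.Probability.Percolation
open scoped Classical BigOperators

/-- TTRL-lite variant V2510 (small cases `A.card = 2` and `n ≤ 2` combined) of the shortening
step of `stmt-CriticalPhenomena-4574`.  The side conditions are incompatible: since `v ∉ A`,
the finset `insert v A : Finset (Fin n)` has `3 = (insert v A).card ≤ Fintype.card (Fin n) = n ≤ 2`,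
so the statement holds vacuously (same argument as the sibling variant V2522). -/
theorem stub_shorteningStep_var2510 :
    ∀ (n : ℕ) (w : Sym2 (Fin n) → unitInterval) (A : Finset (Fin n)) (b v x a₀ : Fin n), n ≤ 2 → A.card = 2 → v ∉ A → v ≠ x → w s(v, x) = 0 → a₀ ∈ A → (∀ a ∈ A, (prodBernoulli w).real (openConn a₀ b) ≤ (prodBernoulli w).real (openConn a b)) → (∀ w' : Sym2 (Fin n) → unitInterval, (∀ e, w e = 0 → w' e = 0) → ∀ (A' : Finset (Fin n)) (o' b' : Fin n) (t : ℝ), (∀ a ∈ A', t ≤ (prodBernoulli w').real (openConn a b')) → (prodBernoulli w').real (⋃ a ∈ A', openConn o' a) * t ≤ (prodBernoulli w').real (openConn o' b')) → (prodBernoulli (Function.update w s(v, x) 1)).real (⋃ a ∈ A, openConn v a) * (prodBernoulli (Function.update w s(v, x) 1)).real (openConn a₀ b) ≤ (prodBernoulli (Function.update w s(v, x) 1)).real (openConn v b) := by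
  intro n w A b v x a₀ hn hcard hv
  -- `insert v A ⊆ Fin n` has at most `n ≤ 2` elements, but card `A.card + 1 = 3` since `v ∉ A`
  have hle : (insert v A).card ≤ Fintype.card (Fin n) := Finset.card_le_univ _
  rw [Fintype.card_fin, Finset.card_insert_of_notMem hv] at hle
  omega

end Summit.CriticalPhenomena.PercolationContinuityZ3.Theorems
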